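import Mathlib
import Summits.ABC.ABC.Theses.IneffectiveSubspace
import Summits.ABC.ABC.Theorems.IneffectiveSubspaceTowerFourSubLiouvilleStubTransfer

/-!
# Strategist sketch — crux stmt-ABC-1649 `TowerFourSubLiouville` (wall-breaker census, typed part)

Companion of `STRATEGY-CENSUS.md` (planner-cstrat-stmt-ABC-1649-p1-0, 2026-08-17).  Every
`S⁺` of the census `## Strengthen` section and every split of `## Decomposition` is typed here over
existing declarations, together with the (elementary) implications to the crux-equivalent core
`UBQ η` (`stub_coreIffCrux`, p87895) and hence to the crux via the landed `stub_transfer` (p86153).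
Nothing here is an engine: the file certifies that the census's statements are well-typed and that
their edges to the crux are one-liners, so that "why no leverage" is a statement about MECHANISMS,
not about typing.
-/

set_option linter.dupNamespace false

namespace Summit.ABC.ABC.Cruxes.TowerFourSubLiouville.Strategist

open Summit.ABC.ABC.Theses.IneffectiveSubspace

/-- The crux-equivalent core matrix `UBQ η` (verbatim the hypothesis of `stub_transfer`, p86153;
crux ⟺ `∃ η > 0, UBQ η` by `stub_coreIffCrux`, p87895, with `H = 0`). -/
def UBQ (η : ℝ) : Prop :=
  ∃ Z₀ : ℕ, ∀ v w Y Z : ℕ, Z₀ ≤ Z → 0 < v → 0 < w → 0 < Y → Nat.Coprime (v * Y) (w * Z) →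
    ((max v w : ℕ) : ℝ) ≤ (Z : ℝ) ^ η → w * Z ^ 4 ≠ v * Y ^ 4 →
    (Z : ℝ) ^ η < |((w * Z ^ 4 : ℕ) : ℝ) - ((v * Y ^ 4 : ℕ) : ℝ)|

/-- The crux follows from `UBQ η` for one `η > 0` (landed transfer, p86153). -/
theorem crux_of_ubq {η : ℝ} (hη : 0 < η) (h : UBQ η) : TowerFourSubLiouville :=
  Summit.ABC.ABC.Theorems.TowerFourSubLiouville.stub_transfer ⟨η, hη, h⟩

/-! ## Strengthen: the moving-target ladder above the core

`UBQ η` is "moving LIOUVILLE + η": a saving `Z^η` over Liouville's `|wZ⁴ − vY⁴| ≥ 1` for Kummer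
quartic targets `⁴√(w/v)` of height `≤ (η/4) log Z`.  The two classical rungs above it, in the
uniform `(ε, η)` form forced by the diagonal argument (census §Strengthen S⁺2/S⁺3): -/

/-- **S⁺2 — uniform MOVING THUE for the binomial quartic family**: saving `Z^{1−ε}` (Thue's exponent
`3 + ε` for `⁴√(w/v)`) uniformly for coefficients up to `Z^η`, `η = η(ε)`.  Random model: plausible for
every `η < 1 + ε`; no engine (Bombieri–Gubler Thm 6.5.2 needs the targets in ONE number field `F`). -/
def UniformMovingThue4 : Prop :=
  ∀ ε : ℝ, 0 < ε → ε < 1 → ∃ η : ℝ, 0 < η ∧ ∃ Z₀ : ℕ, ∀ v w Y Z : ℕ, Z₀ ≤ Z → 0 < v → 0 < w → 0 < Y →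
    Nat.Coprime (v * Y) (w * Z) → ((max v w : ℕ) : ℝ) ≤ (Z : ℝ) ^ η → w * Z ^ 4 ≠ v * Y ^ 4 →
    (Z : ℝ) ^ (1 - ε) < |((w * Z ^ 4 : ℕ) : ℝ) - ((v * Y ^ 4 : ℕ) : ℝ)|

/-- **S⁺3 — uniform MOVING ROTH / Vojta's conjecture for `(ℙ¹ × ℙ¹, D)` in the wedge `h₁ ≤ η h₂`**
(`D` = the smooth rational curve `vY⁴ = wZ⁴` of bidegree `(1,4)`): saving `Z^{2−ε}`.  Random model:
needs `η < ε` (count `T^{η−ε}` per dyadic block); Ru–Vojta's general theorem gives only the constant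
`8 > 4 + η` (Liouville) on this pair (census §Strengthen S⁺3). -/
def UniformMovingRoth4 : Prop :=
  ∀ ε : ℝ, 0 < ε → ε < 1 → ∃ η : ℝ, 0 < η ∧ ∃ Z₀ : ℕ, ∀ v w Y Z : ℕ, Z₀ ≤ Z → 0 < v → 0 < w → 0 < Y →
    Nat.Coprime (v * Y) (w * Z) → ((max v w : ℕ) : ℝ) ≤ (Z : ℝ) ^ η → w * Z ^ 4 ≠ v * Y ^ 4 →
    (Z : ℝ) ^ (2 - ε) < |((w * Z ^ 4 : ℕ) : ℝ) - ((v * Y ^ 4 : ℕ) : ℝ)|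

/-- Shrinking `η` preserves a uniform saving statement of exponent `σ` (monotonicity in the
coefficient dial). -/
theorem saving_mono_eta {σ η η' : ℝ} (hle : η' ≤ η) {Z₀ : ℕ}
    (h : ∀ v w Y Z : ℕ, Z₀ ≤ Z → 0 < v → 0 < w → 0 < Y → Nat.Coprime (v * Y) (w * Z) →
      ((max v w : ℕ) : ℝ) ≤ (Z : ℝ) ^ η → w * Z ^ 4 ≠ v * Y ^ 4 →
      (Z : ℝ) ^ σ < |((w * Z ^ 4 : ℕ) : ℝ) - ((v * Y ^ 4 : ℕ) : ℝ)|) :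
    ∀ v w Y Z : ℕ, max Z₀ 1 ≤ Z → 0 < v → 0 < w → 0 < Y → Nat.Coprime (v * Y) (w * Z) →
      ((max v w : ℕ) : ℝ) ≤ (Z : ℝ) ^ η' → w * Z ^ 4 ≠ v * Y ^ 4 →
      (Z : ℝ) ^ σ < |((w * Z ^ 4 : ℕ) : ℝ) - ((v * Y ^ 4 : ℕ) : ℝ)| := by
  intro v w Y Z hZ hv hw hY hcop hmax hne
  have hZ1 : (1 : ℝ) ≤ (Z : ℝ) := by exact_mod_cast (le_trans (le_max_right _ _) hZ)
  have hmono : (Z : ℝ) ^ η' ≤ (Z : ℝ) ^ η := Real.rpow_le_rpow_of_exponent_le hZ1 hle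
  exact h v w Y Z (le_trans (le_max_left _ _) hZ) hv hw hY hcop (hmax.trans hmono) hne

/-- Moving Thue ⟹ the core with `η = min η(1/2) (1/2)` (take `ε = 1/2`). -/
theorem ubq_of_uniformMovingThue4 (h : UniformMovingThue4) : ∃ η : ℝ, 0 < η ∧ UBQ η := by
  obtain ⟨η, hη, Z₀, hU⟩ := h (1 / 2) (by norm_num) (by norm_num)
  refine ⟨min η (1 / 2), lt_min hη (by norm_num), max Z₀ 1, ?_⟩
  intro v w Y Z hZ hv hw hY hcop hmax hne
  have hZ1 : (1 : ℝ) ≤ (Z : ℝ) := by exact_mod_cast (le_trans (le_max_right _ _) hZ)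
  have key := saving_mono_eta (σ := 1 - 1 / 2) (min_le_left η (1 / 2)) hU v w Y Z hZ hv hw hY hcop hmax hne
  have hexp : (Z : ℝ) ^ (min η (1 / 2)) ≤ (Z : ℝ) ^ (1 - 1 / 2 : ℝ) :=
    Real.rpow_le_rpow_of_exponent_le hZ1 (by
      have := min_le_right η (1 / 2); linarith)
  exact lt_of_le_of_lt hexp key

/-- Moving Roth ⟹ Moving Thue (saving `2 − ε ≥ 1 − ε`). -/
theorem uniformMovingThue4_of_roth (h : UniformMovingRoth4) : UniformMovingThue4 := by
  intro ε hε hε1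
  obtain ⟨η, hη, Z₀, hU⟩ := h ε hε hε1
  refine ⟨η, hη, max Z₀ 1, ?_⟩
  intro v w Y Z hZ hv hw hY hcop hmax hne
  have hZ1 : (1 : ℝ) ≤ (Z : ℝ) := by exact_mod_cast (le_trans (le_max_right _ _) hZ)
  have key := hU v w Y Z (le_trans (le_max_left _ _) hZ) hv hw hY hcop hmax hne
  have hexp : (Z : ℝ) ^ (1 - ε) ≤ (Z : ℝ) ^ (2 - ε) :=
    Real.rpow_le_rpow_of_exponent_le hZ1 (by linarith)
  exact lt_of_le_of_lt hexp key

/-- The typed edges of the ladder: `UniformMovingRoth4 ⟹ UniformMovingThue4 ⟹ crux`. -/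
theorem crux_of_uniformMovingThue4 (h : UniformMovingThue4) : TowerFourSubLiouville := by
  obtain ⟨η, hη, hU⟩ := ubq_of_uniformMovingThue4 h
  exact crux_of_ubq hη hU

theorem crux_of_uniformMovingRoth4 (h : UniformMovingRoth4) : TowerFourSubLiouville :=
  crux_of_uniformMovingThue4 (uniformMovingThue4_of_roth h)

/-! ## Decomposition candidates (typed; REJECTED in the census — the second piece is always the crux reworded)

A split of the core along a predicate `P` on quadruples: `UBQ` on `P` and `UBQ` off `P`. -/

/-- The core restricted to the quadruples satisfying `P`. -/
def UBQOn (P : ℕ → ℕ → ℕ → ℕ → Prop) (η : ℝ) : Prop :=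
  ∃ Z₀ : ℕ, ∀ v w Y Z : ℕ, Z₀ ≤ Z → P v w Y Z → 0 < v → 0 < w → 0 < Y → Nat.Coprime (v * Y) (w * Z) →
    ((max v w : ℕ) : ℝ) ≤ (Z : ℝ) ^ η → w * Z ^ 4 ≠ v * Y ^ 4 →
    (Z : ℝ) ^ η < |((w * Z ^ 4 : ℕ) : ℝ) - ((v * Y ^ 4 : ℕ) : ℝ)|

/-- **Dc1 — the unit slice** `a ∣ 4` (`a = |wZ⁴ − vY⁴|`; N9 / BN5: the enemy is then the half-period
datum of `√(vw)`, Cohn–Ljunggren index theorems apply, the residue is a regulator/shape statement). -/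
def unitSlice (v w Y Z : ℕ) : Prop := ((w * Z ^ 4 : ℤ) - (v * Y ^ 4 : ℤ)) ∣ 4

/-- **Dc2 — the anchored slice**: `w/v` is within `w^{-1/2}`… of a fourth power of height `≤ H₀`:
typed crudely as "some `p⁴ v` is close to `q⁴ w` with `p, q ≤ B`" for a fixed box `B` (the
hypergeometric/Thue–Siegel stratum S1; thin). -/
def anchoredSlice (B : ℕ) (v w _Y _Z : ℕ) : Prop :=
  ∃ p q : ℕ, 0 < p ∧ 0 < q ∧ p ≤ B ∧ q ≤ B ∧ p ^ 4 * v ≠ q ^ 4 * w ∧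
    2 * (((p ^ 4 * v : ℕ) : ℤ) - ((q ^ 4 * w : ℕ) : ℤ)).natAbs ^ 2 ≤ q ^ 4 * w

/-- The glue of any such split is a two-line case distinction (so a split is only as good as its
OFF-piece; for Dc1/Dc2/Dc3 the off-piece contains the generic enemy = the crux, census §Decomposition). -/
theorem ubq_of_split (P : ℕ → ℕ → ℕ → ℕ → Prop) {η : ℝ}
    (hon : UBQOn P η) (hoff : UBQOn (fun v w Y Z => ¬ P v w Y Z) η) : UBQ η := by
  classical
  obtain ⟨Z₁, h₁⟩ := hon
  obtain ⟨Z₂, h₂⟩ := hoff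
  refine ⟨max Z₁ Z₂, fun v w Y Z hZ hv hw hY hcop hmax hne => ?_⟩
  by_cases hP : P v w Y Z
  · exact h₁ v w Y Z (le_trans (le_max_left _ _) hZ) hP hv hw hY hcop hmax hne
  · exact h₂ v w Y Z (le_trans (le_max_right _ _) hZ) hP hv hw hY hcop hmax hne

/-! ## Transfer (typed reminder): the function-field sibling holds with room

Over `k[t]` the core holds for every `η < 2/3` by Mason–Stothers (`Polynomial.abc` in Mathlib):
`deg(wZ⁴) ≤ deg rad(avwYZ) − 1`.  We only record the degree inequality that the transfer would need
over `ℤ` and cannot get: "`4·log Z ≤ (2 + 3η)·log Z + O(1)`", i.e. an abc-quality bound `< 2` on the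
binomial family — `Negative.Framing.towerFourSubLiouville_of_abc` (p74157) is its conditional form. -/

/-- The numerical heart of every transfer attempt: quality `4/(2+3η) ≥ 2 − δ` needs `η ≤ 4δ/(6 − 3δ)`;
in particular for `η < 2/3` the function-field degree count `4 ≤ 2 + 3η` is violated. -/
theorem functionField_room {η : ℝ} (hη : η < 2 / 3) : ¬ (4 : ℝ) ≤ 2 + 3 * η := by
  intro h; linarith

end Summit.ABC.ABC.Cruxes.TowerFourSubLiouville.Strategist
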